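import Mathlib
import Summits.CriticalPhenomena.CardyFormulaZ2.Theorems.CardySelfRefinementGradientComparabilityStubSlopeBoundsTransferBulk
import Summits.CriticalPhenomena.CardyFormulaZ2.Theorems.CardySelfRefinementGradientComparabilityStubSlopeBoundsStageA
import HarnessLib

/-!
# Slope bounds, Stage D (boundary layer): reduction of the layer bound to a deterministic surgery

Crux `stmt-CriticalPhenomena-10269`
(`Summit.CriticalPhenomena.CardyFormulaZ2.Theses.CardySelfRefinement.GradientComparability`),
line `monotone-product-coordinates`, helper file of the registered sub-goal `axialLayer_pivotal_le`
(Stage D of `stub_slopeBounds`).  Vocabulary (`ax M Aloc window edgeOf`) from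
`CardySelfRefinementDefs`; the cost of a local modification under `M_k(ρ,c)`
(`M_real_exists_modification_le`, `…StubSlopeBoundsModification`), the offset bookkeeping
(`exists_eq_edgeOf_of_adj`, `…StubNonAxialShareBulk`) and `not_isPivotal_Aloc_of_notMem_window`
(`…StubSlopeBoundsStageA`) are reused.

## Mathematics

Stage D asks: for the axial window edges `e` having an end within (macroscopic) distance `r` of a
side of some quad of the family (the *layer* `Wl`),
`Σ_{e ∈ Wl} M(e pivotal for Aloc) ≤ C · Σ_{e ∈ Wn} M(e pivotal for Aloc)` over the non-axial window
edges `Wn`, with `r, C, η₁` depending on `k, F, δ, c_lo, c_hi` only.  The bulk analogue (Stage B,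
`nonAxialShare_bulk_M`) is the deterministic surgery `local_modification` (which needs a free ball
of radius `20η` inside the failing quad around the edge) followed by finite energy and a double
counting.  This file proves that the SAME probabilistic half works in the layer with NO room
requirement: **if** every pivotal axial layer edge `edgeOf (v,d)` admits, for meshes `η < η₅`, a
modification of the configuration on genuine edges within `R` lattice steps of `v` after which some
NON-AXIAL edge within `R` steps of `v` is pivotal (hypothesis `LayerLocalModification`, the exact
shape of the conclusion of `local_modification` with `4 ↦ R` and the `r`-far hypothesis replaced by
`r₅`-near), **then** Stage D holds with `r = r₅`, `η₁ = η₅`,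
`C = (2K)^{|I₀|}·|I₀|`, `K = 2^k/δ + 1/c_lo + 1/(1-c_hi)`, `|I₀| = 2(2R+1)²`
(`axialLayer_pivotal_le_of_layerModification`, registered helper).  Per edge
(`M_real_isPivotal_le_sum_targets_of_modification`): cover `{e pivotal}` by the events "some
modification on the `|I₀|` candidate edges lands in `{t pivotal}`" over the non-axial targets `t`,
each of cost `(2K)^{|I₀|}` (`M_real_exists_modification_le`); then exchange the sums (each offset
map `e ↦ t` is injective) and drop the targets outside the window, which are never pivotal.

What remains of Stage D is therefore the purely deterministic/topological statement
`LayerLocalModification k m F` about Jordan quads and lattice paths (see the report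
`axialLayer_report.md` of the line folder: it is false at a fixed mesh — thin aligned corridors —
and can only hold for `η` below a scale of `F`, via a crosscut classification of the no-room edges).
-/

noncomputable section

namespace Summit.CriticalPhenomena.CardyFormulaZ2.Theorems.CardySelfRefinement

open scoped Topology
open Filter Set MeasureTheory
open Literature.Probability.LatticeModels Literature.Probability.Percolation
open Literature.Probability.Percolation.QuadCrossing
open Summit.CriticalPhenomena.CardyFormulaZ2.Theses.CardySelfRefinement

-- adapted from …StubNonAxialShareBulk.exists_target_of_near (radius 4 ↦ R)
/-- A genuine edge within `R` steps of `v` is a shifted `edgeOf` with offset in `[-R, R]²`. -/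
theorem exists_target_of_near_radius {R : ℕ} {v : Site 2} {x : Sym2 (Site 2)}
    (hx : ∃ a b, x = s(a, b) ∧ (zdGraph 2).Adj a b ∧
      ∀ i, |a i - v i| ≤ (R : ℤ) ∧ |b i - v i| ≤ (R : ℤ)) :
    ∃ ι : (ℤ × ℤ) × Fin 2, (|ι.1.1| ≤ (R : ℤ) ∧ |ι.1.2| ≤ (R : ℤ)) ∧
      edgeOf (v + ![ι.1.1, ι.1.2], ι.2) = x := by
  obtain ⟨a, b, hxab, hab, hnear⟩ := hx
  rw [hxab]
  obtain ⟨d, h | h⟩ := exists_eq_edgeOf_of_adj hab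
  · refine ⟨((a 0 - v 0, a 1 - v 1), d), ⟨(hnear 0).1, (hnear 1).1⟩, ?_⟩
    show edgeOf (v + ![a 0 - v 0, a 1 - v 1], d) = s(a, b)
    rw [show v + ![a 0 - v 0, a 1 - v 1] = a by ext i; fin_cases i <;> simp]; exact h.symm
  · refine ⟨((b 0 - v 0, b 1 - v 1), d), ⟨(hnear 0).2, (hnear 1).2⟩, ?_⟩
    show edgeOf (v + ![b 0 - v 0, b 1 - v 1], d) = s(a, b)
    rw [show v + ![b 0 - v 0, b 1 - v 1] = b by ext i; fin_cases i <;> simp]; exact h.symm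

-- adapted from …StubSlopeBoundsTransferBulk.M_real_isPivotal_le_sum_targets
--   (`local_modification` ↦ hypothesis `hmod`, radius 4 ↦ R, 162 ↦ |I₀|)
/-- **Per-edge transfer under `M_k(ρ,c)` from a given local modification.**  If every configuration
in which `edgeOf vd` is pivotal for `Aloc` can be modified on genuine edges within `R` steps of
`vd.1` so that some NON-AXIAL `edgeOf (v',d')` with `|v' - vd.1|_∞ ≤ R` becomes pivotal, then for
`0 ≤ ρ < 1`, `0 < c < 1`:
`M(edgeOf vd pivotal) ≤ (2K)^{|I₀|} Σ M(edgeOf t pivotal)` over the non-axial targets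
`t = (vd.1 + Δ, vd.2 + ρ')`, `(Δ, ρ') ∈ I₀ = [-R,R]² × Fin 2`, `K = 2^k/(1-ρ) + 1/c + 1/(1-c)`. -/
theorem M_real_isPivotal_le_sum_targets_of_modification {k : ℕ} (hk : 0 < k) {m : ℕ}
    (F : Fin m → Quad (Set.univ : Set ℂ)) {η : ℝ} (hη : 0 < η)
    {ρ : ℝ} (hρ : ρ ∈ Set.Ico (0 : ℝ) 1) {c : ℝ} (hc : c ∈ Set.Ioo (0 : ℝ) 1) (R : ℕ)
    (I₀ : Finset ((ℤ × ℤ) × Fin 2)) (hI₀ : ∀ ι, ι ∈ I₀ ↔ |ι.1.1| ≤ (R : ℤ) ∧ |ι.1.2| ≤ (R : ℤ))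
    (vd : Site 2 × Fin 2)
    (hmod : ∀ ω : BondConfig (Site 2), IsPivotal (Aloc m F η) (edgeOf vd) ω →
      ∃ (Rm S : Set (Sym2 (Site 2))) (e' : Sym2 (Site 2)),
        (∃ (v' : Site 2) (d' : Fin 2), e' = edgeOf (v', d') ∧ ¬ ax k (v', d') ∧
          ∀ i, |v' i - vd.1 i| ≤ (R : ℤ)) ∧
        (∀ x ∈ Rm ∪ S, ∃ a b : Site 2, x = s(a, b) ∧ (zdGraph 2).Adj a b ∧
          ∀ i, |a i - vd.1 i| ≤ (R : ℤ) ∧ |b i - vd.1 i| ≤ (R : ℤ)) ∧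
        IsPivotal (Aloc m F η) e' ((ω \ Rm) ∪ S)) :
    (M k ρ c).real {ω | IsPivotal (Aloc m F η) (edgeOf vd) ω} ≤
      (2 * (2 ^ k / (1 - ρ) + 1 / c + 1 / (1 - c))) ^ I₀.card *
        ∑ ι ∈ I₀.filter (fun ι => ¬ ax k (vd.1 + ![ι.1.1, ι.1.2], vd.2 + ι.2)),
          (M k ρ c).real
            {ω | IsPivotal (Aloc m F η) (edgeOf (vd.1 + ![ι.1.1, ι.1.2], vd.2 + ι.2)) ω} := by
  classical
  obtain ⟨v, d⟩ := vd
  dsimp only at hmod ⊢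
  haveI := isProbabilityMeasure_M k ρ c
  set μ := M k ρ c with hμ
  obtain ⟨L, hL⟩ : ∃ L : ℝ, L = 2 * (2 ^ k / (1 - ρ) + 1 / c + 1 / (1 - c)) := ⟨_, rfl⟩
  rw [← hL]
  have hL1 : 1 ≤ L := by
    have hA : 0 ≤ (2 : ℝ) ^ k / (1 - ρ) := div_nonneg (by positivity) (by linarith [hρ.2])
    have hB : 1 ≤ 1 / c := by rw [le_div_iff₀ hc.1]; linarith [hc.2]
    have hC : 0 ≤ 1 / (1 - c) := div_nonneg zero_le_one (by linarith [hc.2])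
    rw [hL]
    linarith
  obtain ⟨N, hN_def⟩ : ∃ N : Finset (Sym2 (Site 2)),
      N = I₀.image fun ι => edgeOf (v + ![ι.1.1, ι.1.2], ι.2) := ⟨_, rfl⟩
  have hN : ∀ e ∈ N, ∃ (v' : Site 2) (d' : Fin 2), e = edgeOf (v', d') := by
    intro x hx
    rw [hN_def] at hx
    obtain ⟨ι, -, hι⟩ := Finset.mem_image.1 hx
    exact ⟨_, _, hι.symm⟩
  have hNcard : N.card ≤ I₀.card := by rw [hN_def]; exact Finset.card_image_le
  have hmeas : ∀ e, MeasurableSet {ω : BondConfig (Site 2) | IsPivotal (Aloc m F η) e ω} := fun e =>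
    measurableSet_setOf_isPivotal (measurableSet_Aloc m F hη.ne') e
  have hmodN : ∀ E : Set (BondConfig (Site 2)), MeasurableSet E →
      μ.real {ω | ∃ Rm S : Set (Sym2 (Site 2)), Rm ∪ S ⊆ ↑N ∧ ω \ Rm ∪ S ∈ E} ≤
        L ^ I₀.card * μ.real E := by
    intro E hE
    have h := M_real_exists_modification_le k hk ρ hρ c hc N hN E hE
    rw [← hL] at h
    exact h.trans (mul_le_mul_of_nonneg_right (pow_le_pow_right₀ hL1 hNcard) measureReal_nonneg)
  have hcov : {ω : BondConfig (Site 2) | IsPivotal (Aloc m F η) (edgeOf (v, d)) ω} ⊆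
      ⋃ ι ∈ I₀.filter (fun ι => ¬ ax k (v + ![ι.1.1, ι.1.2], d + ι.2)),
        {ω | ∃ Rm S : Set (Sym2 (Site 2)), Rm ∪ S ⊆ ↑N ∧
          ω \ Rm ∪ S ∈ {ω | IsPivotal (Aloc m F η) (edgeOf (v + ![ι.1.1, ι.1.2], d + ι.2)) ω}} := by
    intro ω hω
    obtain ⟨Rm, S, e', ⟨v', d', he', hnax, hv'⟩, hnear, hpiv'⟩ := hmod ω hω
    have hvv' : v + ![v' 0 - v 0, v' 1 - v 1] = v' := by ext i; fin_cases i <;> simp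
    have hdd' : d + (d' - d) = d' := by abel
    refine Set.mem_iUnion₂.2 ⟨((v' 0 - v 0, v' 1 - v 1), d' - d), Finset.mem_filter.2 ⟨?_, ?_⟩,
      Rm, S, fun x hx => ?_, ?_⟩
    · exact (hI₀ _).2 ⟨hv' 0, hv' 1⟩
    · show ¬ ax k (v + ![v' 0 - v 0, v' 1 - v 1], d + (d' - d))
      rw [hvv', hdd']; exact hnax
    · obtain ⟨ι, hι, hιx⟩ := exists_target_of_near_radius (hnear x hx)
      rw [Finset.mem_coe, hN_def, Finset.mem_image]
      exact ⟨ι, (hI₀ ι).2 hι, hιx⟩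
    · show ω \ Rm ∪ S ∈
        {ω | IsPivotal (Aloc m F η) (edgeOf (v + ![v' 0 - v 0, v' 1 - v 1], d + (d' - d))) ω}
      rw [hvv', hdd', ← he']; exact hpiv'
  calc μ.real {ω | IsPivotal (Aloc m F η) (edgeOf (v, d)) ω}
      ≤ μ.real (⋃ ι ∈ I₀.filter (fun ι => ¬ ax k (v + ![ι.1.1, ι.1.2], d + ι.2)),
          {ω | ∃ Rm S : Set (Sym2 (Site 2)), Rm ∪ S ⊆ ↑N ∧
            ω \ Rm ∪ S ∈ {ω | IsPivotal (Aloc m F η) (edgeOf (v + ![ι.1.1, ι.1.2], d + ι.2)) ω}}) :=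
        measureReal_mono hcov (measure_ne_top _ _)
    _ ≤ ∑ ι ∈ I₀.filter (fun ι => ¬ ax k (v + ![ι.1.1, ι.1.2], d + ι.2)),
          μ.real {ω | ∃ Rm S : Set (Sym2 (Site 2)), Rm ∪ S ⊆ ↑N ∧
            ω \ Rm ∪ S ∈ {ω | IsPivotal (Aloc m F η) (edgeOf (v + ![ι.1.1, ι.1.2], d + ι.2)) ω}} :=
        measureReal_biUnion_finset_le (μ := μ) _ _
    _ ≤ ∑ ι ∈ I₀.filter (fun ι => ¬ ax k (v + ![ι.1.1, ι.1.2], d + ι.2)),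
          L ^ I₀.card * μ.real {ω | IsPivotal (Aloc m F η) (edgeOf (v + ![ι.1.1, ι.1.2], d + ι.2)) ω} :=
        Finset.sum_le_sum fun ι _ => hmodN _ (hmeas _)
    _ = _ := by rw [Finset.mul_sum]

-- adapted from …StubSlopeBoundsTransferBulk.nonAxialShare_bulk_M (bulk ↦ layer, surgery ↦ hypothesis)
/-- **Stage D of `stub_slopeBounds` reduced to a deterministic layer surgery** (registered helper
`axialLayer_pivotal_le_of_layerModification` of the sub-goal `axialLayer_pivotal_le`).  Fix
`k ∈ {2,3}` and a nonempty finite quad family `F`.  Suppose (`LayerLocalModification`): there are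
`R : ℕ`, `r₅ > 0`, `η₅ > 0` such that for every mesh `η ∈ (0, η₅)`, every axial edge
`edgeOf (v,d)` having an end within distance `r₅` of a side of some `F i`, and every configuration
`ω` in which it is pivotal for the localised joint crossing event `Aloc m F η`, some NON-AXIAL edge
`edgeOf (v',d')` with `|v' - v|_∞ ≤ R` is pivotal in a configuration `(ω ∖ Rm) ∪ S` with `Rm ∪ S`
made of genuine edges within `R` steps of `v`.  Then the boundary-layer bound of Stage D holds:
for all `δ > 0`, `0 < c_lo`, `c_hi < 1` there are `r, C, η₁ > 0` (namely `r = r₅`, `η₁ = η₅`,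
`C = (2K)^{|I₀|}|I₀|`, `K = 2^k/δ + 1/c_lo + 1/(1-c_hi)`, `I₀ = [-R,R]² × Fin 2`) with
`Σ_{e ∈ Wl} M_k(ρ,c)(e pivotal) ≤ C Σ_{e ∈ Wn} M_k(ρ,c)(e pivotal)` for every `η < η₁`,
`ρ ∈ [0,1-δ]`, `c ∈ [c_lo,c_hi]`, the layer `Wl` of axial window edges with an end `r`-near a side and
the set `Wn` of non-axial window edges. -/
theorem axialLayer_pivotal_le_of_layerModification : ∀ k : ℕ, k = 2 ∨ k = 3 → ∀ (m : ℕ) (F : Fin m → Quad (Set.univ : Set ℂ)), 0 < m → (∃ (R : ℕ) (r₅ η₅ : ℝ), 0 < r₅ ∧ 0 < η₅ ∧ ∀ η ∈ Set.Ioo 0 η₅, ∀ (v : Site 2) (d : Fin 2), ax k (v, d) → (∃ x ∈ edgeOf (v, d), ∃ (i : Fin m) (j : Fin 4), ∃ p ∈ (F i).side j, dist ((η : ℂ) * squareLatticeEmbedding.z x) p < r₅) → ∀ ω : BondConfig (Site 2), IsPivotal (Aloc m F η) (edgeOf (v, d)) ω → ∃ (Rm S : Set (Sym2 (Site 2)))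 (e' : Sym2 (Site 2)), (∃ (v' : Site 2) (d' : Fin 2), e' = edgeOf (v', d') ∧ ¬ ax k (v', d') ∧ ∀ i, |v' i - v i| ≤ (R : ℤ)) ∧ (∀ x ∈ Rm ∪ S, ∃ a b : Site 2, x = s(a, b) ∧ (zdGraph 2).Adj a b ∧ ∀ i, |a i - v i| ≤ (R : ℤ) ∧ |b i - v i| ≤ (R : ℤ)) ∧ IsPivotal (Aloc m F η) e' ((ω \ Rm) ∪ S)) → ∀ δ cl ch : ℝ, 0 < δ → 0 < cl → ch < 1 → ∃ r C η₁ : ℝ, 0 < r ∧ 0 < η₁ ∧ ∀ η ∈ Set.Ioo 0 η₁, ∀ ρ ∈ Set.Icc (0 : ℝ) (1 - δ), ∀ c ∈ Set.Icc cl ch, ∀ Wl Wn : Finset (Sym2 (Site 2)), (∀ e, e ∈ Wl ↔ e ∈ window m F η ∧ (∃ (v : Site 2) (d : Fin 2), e = edgeOf (v, d) ∧ ax k (v, d)) ∧ ∃ x ∈ e, ∃ (i : Fin m) (j : Fin 4), ∃ p ∈ (F i).side j, dist ((η : ℂ) * squareLatticeEmbedding.z x) p < r) → (∀ e, e ∈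 Wn ↔ e ∈ window m F η ∧ ∃ (v : Site 2) (d : Fin 2), e = edgeOf (v, d) ∧ ¬ ax k (v, d)) → ∑ e ∈ Wl, (M k ρ c).real {ω | IsPivotal (Aloc m F η) e ω} ≤ C * ∑ e ∈ Wn, (M k ρ c).real {ω | IsPivotal (Aloc m F η) e ω} := by
  intro k hk m F _ hH δ cl ch hδ hcl hch
  obtain ⟨R, r₅, η₅, hr₅, hη₅, hmodif⟩ := hH
  classical
  -- the offsets `(Δ, ρ')`, `|Δ|_∞ ≤ R`
  obtain ⟨I₀, hI₀⟩ : ∃ I₀ : Finset ((ℤ × ℤ) × Fin 2),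
      ∀ ι, ι ∈ I₀ ↔ |ι.1.1| ≤ (R : ℤ) ∧ |ι.1.2| ≤ (R : ℤ) := by
    refine ⟨(Finset.Icc (-(R : ℤ)) R ×ˢ Finset.Icc (-(R : ℤ)) R) ×ˢ (Finset.univ : Finset (Fin 2)),
      fun ι => ?_⟩
    simp only [Finset.mem_product, Finset.mem_Icc, Finset.mem_univ, and_true, abs_le]
  -- the uniform constant
  obtain ⟨Lm, hLm⟩ : ∃ Lm : ℝ, Lm = 2 * (2 ^ k / δ + 1 / cl + 1 / (1 - ch)) := ⟨_, rfl⟩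
  have hLm0 : 0 < Lm := by
    have hA : 0 ≤ (2 : ℝ) ^ k / δ := div_nonneg (by positivity) hδ.le
    have hB : 0 < 1 / cl := div_pos one_pos hcl
    have hC : 0 ≤ 1 / (1 - ch) := div_nonneg zero_le_one (by linarith)
    rw [hLm]
    linarith
  refine ⟨r₅, Lm ^ I₀.card * I₀.card, η₅, hr₅, hη₅, fun η hη ρ hρ c hc Wl Wn hWl hWn => ?_⟩
  have hη0 : 0 < η := hη.1
  have hk0 : 0 < k := by rcases hk with rfl | rfl <;> norm_num
  have hρ' : ρ ∈ Set.Ico (0 : ℝ) 1 := ⟨hρ.1, by linarith [hρ.2]⟩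
  have hc' : c ∈ Set.Ioo (0 : ℝ) 1 := ⟨lt_of_lt_of_le hcl hc.1, lt_of_le_of_lt hc.2 hch⟩
  -- the constant at `(ρ, c)` is dominated by the uniform one
  obtain ⟨L, hL⟩ : ∃ L : ℝ, L = 2 * (2 ^ k / (1 - ρ) + 1 / c + 1 / (1 - c)) := ⟨_, rfl⟩
  have hLLm : L ≤ Lm := by
    have hA : (2 : ℝ) ^ k / (1 - ρ) ≤ 2 ^ k / δ :=
      div_le_div_of_nonneg_left (by positivity) hδ (by linarith [hρ.2])
    have hB : 1 / c ≤ 1 / cl := one_div_le_one_div_of_le hcl hc.1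
    have hC : 1 / (1 - c) ≤ 1 / (1 - ch) := one_div_le_one_div_of_le (by linarith) (by linarith [hc.2])
    rw [hL, hLm]
    linarith
  have hL0 : 0 ≤ L := by
    have hA : 0 ≤ (2 : ℝ) ^ k / (1 - ρ) := div_nonneg (by positivity) (by linarith [hρ.2])
    have hB : 0 ≤ 1 / c := div_nonneg zero_le_one hc'.1.le
    have hC : 0 ≤ 1 / (1 - c) := div_nonneg zero_le_one (by linarith [hc'.2])
    rw [hL]
    linarith
  have hpowL : L ^ I₀.card ≤ Lm ^ I₀.card := pow_le_pow_left₀ hL0 hLLm _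
  haveI := isProbabilityMeasure_M k ρ c
  set μ := M k ρ c with hμ
  set P : Sym2 (Site 2) → ℝ := fun e => μ.real {ω | IsPivotal (Aloc m F η) e ω} with hP
  have hP0 : ∀ e, 0 ≤ P e := fun e => measureReal_nonneg
  set tgt : Site 2 × Fin 2 → (ℤ × ℤ) × Fin 2 → Site 2 × Fin 2 :=
    fun vd ι => (vd.1 + ![ι.1.1, ι.1.2], vd.2 + ι.2) with htgt
  -- the layer as a set of representatives
  have hinj : Set.InjOn (edgeOf : Site 2 × Fin 2 → Sym2 (Site 2)) (edgeOf ⁻¹' ↑Wl) :=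
    edgeOf_injective.injOn
  set Vl : Finset (Site 2 × Fin 2) := Wl.preimage edgeOf hinj with hVl
  have hsumWl : ∑ e ∈ Wl, P e = ∑ vd ∈ Vl, P (edgeOf vd) := by
    refine (Finset.sum_preimage edgeOf Wl hinj P (fun e he hne => (hne ?_).elim)).symm
    obtain ⟨-, ⟨v, d, rfl, -⟩, -⟩ := (hWl e).1 he
    exact ⟨_, rfl⟩
  -- per-edge transfer from the hypothesis
  have hper : ∀ vd ∈ Vl, P (edgeOf vd) ≤
      Lm ^ I₀.card * ∑ ι ∈ I₀.filter (fun ι => ¬ ax k (tgt vd ι)), P (edgeOf (tgt vd ι)) := by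
    intro vd hvd
    have hmem : edgeOf vd ∈ Wl := Finset.mem_preimage.1 hvd
    obtain ⟨-, ⟨v₁, d₁, h₁, hax₁⟩, hnear⟩ := (hWl (edgeOf vd)).1 hmem
    have hvd₁ : vd = (v₁, d₁) := edgeOf_injective h₁
    subst hvd₁
    have h := M_real_isPivotal_le_sum_targets_of_modification hk0 F hη0 hρ' hc' R I₀ hI₀ (v₁, d₁)
      (fun ω hω => hmodif η hη v₁ d₁ hax₁ hnear ω hω)
    rw [← hL] at h
    exact h.trans (mul_le_mul_of_nonneg_right hpowL (Finset.sum_nonneg fun ι _ => hP0 _))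
  have hinjι : ∀ ι, Function.Injective (fun vd : Site 2 × Fin 2 => edgeOf (tgt vd ι)) := by
    intro ι a b h
    have h' := edgeOf_injective h
    simp only [htgt, Prod.mk.injEq, add_left_inj] at h'
    exact Prod.ext h'.1 h'.2
  -- a non-axial target outside `Wn` is outside the window, hence never pivotal
  have hzero : ∀ (vd : Site 2 × Fin 2) (ι : (ℤ × ℤ) × Fin 2), ¬ ax k (tgt vd ι) →
      edgeOf (tgt vd ι) ∉ Wn → P (edgeOf (tgt vd ι)) = 0 := by
    intro vd ι hnax hnot
    have hw : edgeOf (tgt vd ι) ∉ window m F η := fun hw =>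
      hnot ((hWn _).2 ⟨hw, (tgt vd ι).1, (tgt vd ι).2, rfl, hnax⟩)
    have hempty : {ω : BondConfig (Site 2) | IsPivotal (Aloc m F η) (edgeOf (tgt vd ι)) ω} = ∅ :=
      Set.eq_empty_of_forall_notMem fun ω hω => not_isPivotal_Aloc_of_notMem_window m F η hw ω hω
    show μ.real {ω : BondConfig (Site 2) | IsPivotal (Aloc m F η) (edgeOf (tgt vd ι)) ω} = 0
    rw [hempty, measureReal_empty]
  -- exchange the sums
  have hinner : ∀ ι ∈ I₀, ∑ vd ∈ Vl.filter (fun vd => ¬ ax k (tgt vd ι)), P (edgeOf (tgt vd ι)) ≤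
      ∑ e ∈ Wn, P e := by
    intro ι _
    have himg : ∑ vd ∈ Vl.filter (fun vd => ¬ ax k (tgt vd ι)), P (edgeOf (tgt vd ι)) =
        ∑ e ∈ (Vl.filter (fun vd => ¬ ax k (tgt vd ι))).image (fun vd => edgeOf (tgt vd ι)), P e :=
      (Finset.sum_image fun a _ b _ h => hinjι ι h).symm
    rw [himg, ← Finset.sum_filter_of_ne (p := fun e => e ∈ Wn) (fun e he hne => ?_)]
    · exact Finset.sum_le_sum_of_subset_of_nonneg (fun e he => (Finset.mem_filter.1 he).2)
        (fun e _ _ => hP0 e)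
    · obtain ⟨vd, hvd, rfl⟩ := Finset.mem_image.1 he
      by_contra hnot
      exact hne (hzero vd ι (Finset.mem_filter.1 hvd).2 hnot)
  have hexch : ∑ vd ∈ Vl, ∑ ι ∈ I₀.filter (fun ι => ¬ ax k (tgt vd ι)), P (edgeOf (tgt vd ι)) =
      ∑ ι ∈ I₀, ∑ vd ∈ Vl.filter (fun vd => ¬ ax k (tgt vd ι)), P (edgeOf (tgt vd ι)) := by
    simp only [Finset.sum_filter]
    exact Finset.sum_comm
  calc ∑ e ∈ Wl, P e = ∑ vd ∈ Vl, P (edgeOf vd) := hsumWl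
    _ ≤ ∑ vd ∈ Vl, Lm ^ I₀.card * ∑ ι ∈ I₀.filter (fun ι => ¬ ax k (tgt vd ι)), P (edgeOf (tgt vd ι)) :=
        Finset.sum_le_sum hper
    _ = Lm ^ I₀.card * ∑ ι ∈ I₀, ∑ vd ∈ Vl.filter (fun vd => ¬ ax k (tgt vd ι)), P (edgeOf (tgt vd ι)) := by
        rw [← Finset.mul_sum, hexch]
    _ ≤ Lm ^ I₀.card * ∑ _ι ∈ I₀, ∑ e ∈ Wn, P e :=
        mul_le_mul_of_nonneg_left (Finset.sum_le_sum hinner) (by positivity)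
    _ = Lm ^ I₀.card * I₀.card * ∑ e ∈ Wn, P e := by
        rw [Finset.sum_const, nsmul_eq_mul]; ring

end Summit.CriticalPhenomena.CardyFormulaZ2.Theorems.CardySelfRefinement

end
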